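import Summits.BirchSwinnertonDyer.Rank1Residual.P2.CongruentNumberEvenAokiMonskyKernel
import Summits.BirchSwinnertonDyer.Rank1Residual.P2.CongruentNumberEvenAokiMonskyShape
import HarnessLib

/-!
# Cell `bsd-monsky`: AOKI = MONSKY FOR EVERY NUMBER OF PRIME FACTORS — the theorem:
# `selmerDimFormula (2p₁⋯p_k) = 2 + s(2p₁⋯p_k)` for every square-free `n = 2p₁⋯p_k ≡ 6 (mod 8)`, hence
# `#Sel₂(E_n) = 2^{2 + s(n)}` on the whole class from Aoki's refereed Theorem 2.2 (nothing asserted)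

HONEST FRAMING (cell `bsd-monsky`, run/shared/lean/pub/bsd-monsky/, README §1: ONE theorem on ONE explicit
infinite family of quadratic twists of the congruent number curve at the prime `2`; not "BSD for rank ≤ 1",
nothing at odd primes, nothing booked until the cross-family referee passes the written proof). This file
asserts NO arithmetic fact. It proves, for EVERY `k` and every injective family of primes `p : Fin k → ℕ`
with `n = 2p₁⋯p_k ≡ 6 (mod 8)`:

* `selmerDimFormula_two_mul_prod` — **Aoki 1999 Thm 2.2's closed formula equals `2 + s(n)`**, `s(n)` =
  Monsky's even matrix count `monskySelmerRankEven p` (appendix to Heath-Brown 1994): the two printed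
  `2`-descents for `E_n : y² = x³ − n²x` agree identically on the class `n ≡ 6 (mod 8)`. The tree had this at
  `k = 2` only (`…EvenPairAokiMonsky`, sixteen symbol patterns); here by the linear algebra of
  `…EvenAokiMonskyForms/Kernel.lean` (kernel count `dim ker M + 2 rank Λ_{S₁,T} + rank ᵗΦGΦ = |T| + k`)
  and the dictionary of `…EvenAokiMonskySymbols/Shape.lean` (`λ_{p_j}(p_i) = L_ij`, `Lᵀ = L + εεᵀ + D_ε`,
  `Σ_j L_ji = t_i`, `Σ ε = 1`; `|S| = k + 1`; the row of the prime `2` in `Λ_{S,T}` is the sum of the odd rows;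
  `v(Sel₀) ≅ W` and the Gram matrices correspond under `p : Fin k ≃ S₁`).
* `card_selmerGroup_two_two_mul_prod_of_aoki` — hence, from the named fact
  `Aoki1999.thm22_card_selmerGroup_two` (`hAo`, refereed, complete proof) ALONE:
  `#Sel₂(E_{2p₁⋯p_k}/ℚ) = 2^{2 + s(2p₁⋯p_k)}` for every `k` — i.e. the `n ≡ 6 (mod 8)` case of the named fact
  `HeathBrown1994.monsky_card_selmerGroup_two_even` (`hMe`, printed as "a sketch proof") follows from `hAo`;
  every uniform-in-`k` consumer of `hMe` on this class (the C-P2-2 doors, DOOR B6, the `𝒮⁻`-towers) can be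
  run on `hAo` instead. Nothing per-curve; no numeral of any cell enters a declaration.

References: [Aoki1999] Thm. 2.2 p. 81 and its proof p. 98, Thm. 4.1 p. 87; [HeathBrown1994SelmerCongruentII]
Appendix (Monsky), typescript p. 41 L20–L36, §1 p. 1 L14–L20; [IrelandRosen1990] Ch. 5 §2.
-/

noncomputable section

open scoped Classical

open Matrix WeierstrassCurve Literature.NumberTheory.EllipticCurves
  Literature.NumberTheory.EllipticCurves.Aoki1999
  Literature.NumberTheory.EllipticCurves.HeathBrown1994
  Literature.NumberTheory.EllipticCurves.HeathBrown1994.Families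
  Literature.NumberTheory.QuadraticForms

set_option autoImplicit false

namespace Summit.BirchSwinnertonDyer.Rank1Residual.P2.AokiMonsky

variable {k : ℕ} (p : Fin k → ℕ) (hp : ∀ i, (p i).Prime) (hinj : Function.Injective p)

/-- All `pᵢ` are odd when `2p₁⋯p_k ≡ 6 (mod 8)`. [folklore] -/
theorem odd_of_mod_eight_six (h8 : (2 * ∏ i, p i) % 8 = 6) : ∀ i, Odd (p i) := by
  have hP : Odd (∏ i, p i) := Nat.odd_iff.mpr (by omega)
  exact fun i => hP.of_dvd_nat (Finset.dvd_prod_of_mem p (Finset.mem_univ i))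

include hp hinj in
/-- **The row of the prime `2` is the sum of the odd rows: `rank Λ_{S,T} = rank Λ_{S₁,T}`, and
`Λ_{S₁,T} ≅ L|_{ι × T₁}`** (`λ_{p_j}(2) = t_j = Σ_i L_ij`). [cite: Aoki1999, Thm. 2.2 p. 81, §2 pp. 79–80] -/
theorem rank_lamMatrix_eq (h8 : (2 * ∏ i, p i) % 8 = 6) :
    (lamMatrix (2 * ∏ i, p i) (sSet (2 * ∏ i, p i)) (tSet (2 * ∏ i, p i))).rank =
      (((legendreMatrix p)ᵀ + Matrix.diagonal fun i => addLegendreSym 2 (p i)).submatrix id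
        (Subtype.val : {j // addLegendreSym (-1) (p j) = 0} → Fin k)).rank := by
  have hodd := odd_of_mod_eight_six p h8
  have hS1 := sOneSet_two_mul_prod p hp hodd hinj
  have hT := tSet_two_mul_prod p hp hinj h8
  -- the equivalences `Fin k ≃ S₁`, `{ε = 0} ≃ T`
  have hmemS : ∀ i, p i ∈ sOneSet (2 * ∏ i, p i) := fun i => by
    rw [hS1]; exact Finset.mem_image_of_mem _ (Finset.mem_univ i)
  have hmemT : ∀ j : {j // addLegendreSym (-1) (p j) = 0}, p j.1 ∈ tSet (2 * ∏ i, p i) := fun j => by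
    rw [hT]
    exact Finset.mem_image_of_mem _ (Finset.mem_filter.mpr
      ⟨Finset.mem_univ _, (eps_eq_zero_iff p hodd j.1).mp j.2⟩)
  let eS : Fin k ≃ ↥(sOneSet (2 * ∏ i, p i)) := Equiv.ofBijective (fun i => ⟨p i, hmemS i⟩)
    ⟨fun i j h => hinj (Subtype.ext_iff.mp h), fun x => by
      obtain ⟨xv, hxv⟩ := x
      rw [hS1] at hxv
      obtain ⟨i, -, hi⟩ := Finset.mem_image.mp hxv
      exact ⟨i, Subtype.ext hi⟩⟩
  let eT : {j // addLegendreSym (-1) (p j) = 0} ≃ ↥(tSet (2 * ∏ i, p i)) :=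
    Equiv.ofBijective (fun j => ⟨p j.1, hmemT j⟩)
    ⟨fun i j h => Subtype.ext (hinj (Subtype.ext_iff.mp h)), fun x => by
      obtain ⟨xv, hxv⟩ := x
      rw [hT] at hxv
      obtain ⟨i, hi, hix⟩ := Finset.mem_image.mp hxv
      exact ⟨⟨i, (eps_eq_zero_iff p hodd i).mpr (Finset.mem_filter.mp hi).2⟩, Subtype.ext hix⟩⟩
  -- step 1: dropping the row of `2` does not change the span of the rows
  have h1 : (lamMatrix (2 * ∏ i, p i) (sSet (2 * ∏ i, p i)) (tSet (2 * ∏ i, p i))).rank =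
      (lamMatrix (2 * ∏ i, p i) (sOneSet (2 * ∏ i, p i)) (tSet (2 * ∏ i, p i))).rank := by
    rw [Matrix.rank_eq_finrank_span_row, Matrix.rank_eq_finrank_span_row]
    have hsub : sOneSet (2 * ∏ i, p i) ⊆ sSet (2 * ∏ i, p i) := Finset.filter_subset _ _
    have hspan : Submodule.span (ZMod 2) (Set.range
        (lamMatrix (2 * ∏ i, p i) (sSet (2 * ∏ i, p i)) (tSet (2 * ∏ i, p i))).row) =
        Submodule.span (ZMod 2) (Set.range
          (lamMatrix (2 * ∏ i, p i) (sOneSet (2 * ∏ i, p i)) (tSet (2 * ∏ i, p i))).row) := by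
      apply le_antisymm
      · rw [Submodule.span_le]
        rintro _ ⟨⟨x, hxS⟩, rfl⟩
        have hx := hxS
        rw [sSet_two_mul_prod p hp hinj, Finset.mem_insert] at hx
        rcases hx with h2 | hx
        · -- the row of `2` is the sum of the rows of the odd primes
          have hrow : (lamMatrix (2 * ∏ i, p i) (sSet (2 * ∏ i, p i)) (tSet (2 * ∏ i, p i))).row
              ⟨x, hxS⟩ =
              ∑ i, (lamMatrix (2 * ∏ i, p i) (sOneSet (2 * ∏ i, p i)) (tSet (2 * ∏ i, p i))).row
                (eS i) := by
            funext q
            rw [Finset.sum_apply]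
            obtain ⟨qv, hqv⟩ := q
            have hq := hqv
            rw [hT] at hq
            obtain ⟨j, hj, hjq⟩ := Finset.mem_image.mp hq
            change lam (2 * ∏ i, p i) qv ((x : ℕ) : ℤ) = ∑ i, lam (2 * ∏ i, p i) qv ((p i : ℕ) : ℤ)
            rw [h2, ← hjq, Nat.cast_ofNat, lam_prime_two p hp hodd hinj j,
              ← shapeL_sum_col p j]
            exact Finset.sum_congr rfl fun i _ => (lam_prime_prime_eq_shapeL p hp hodd hinj i j).symm
          rw [hrow]
          exact Submodule.sum_mem _ fun i _ => Submodule.subset_span ⟨eS i, rfl⟩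
        · exact Submodule.subset_span ⟨⟨x, by rw [hS1]; exact hx⟩, rfl⟩
      · apply Submodule.span_mono
        rintro _ ⟨x, rfl⟩
        exact ⟨⟨x, hsub x.2⟩, rfl⟩
    rw [hspan]
  -- step 2: `Λ_{S₁,T}` reindexed is `L|_{ι × T₁}`
  have h2 : (lamMatrix (2 * ∏ i, p i) (sOneSet (2 * ∏ i, p i)) (tSet (2 * ∏ i, p i))).submatrix eS eT =
      ((legendreMatrix p)ᵀ + Matrix.diagonal fun i => addLegendreSym 2 (p i)).submatrix id
        (Subtype.val : {j // addLegendreSym (-1) (p j) = 0} → Fin k) := by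
    ext i j
    change lam (2 * ∏ i, p i) (p j.1) ((p i : ℕ) : ℤ) = _
    rw [Matrix.submatrix_apply, id, lam_prime_prime_eq_shapeL p hp hodd hinj i j.1]
  rw [h1, ← h2, Matrix.rank_submatrix]

include hp hinj in
/-- **Aoki's Gram matrix at the primes `p_i, p_l` is `G_il = Σ_j ε_j L_ij L_lj + δ_il t_i + (t_i ε_l + ε_i t_l)`**
(`S₂ = {ε = 1}`, `ν = 1`, `λ₂(p_i) = t_i`, `ε₂(p_l) = ε_l`). [cite: Aoki1999, Thm. 2.2 p. 81, proof p. 98] -/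
theorem gramMatrix_prime_prime (h8 : (2 * ∏ i, p i) % 8 = 6) (i l : Fin k)
    (hi : p i ∈ sOneSet (2 * ∏ i, p i)) (hl : p l ∈ sOneSet (2 * ∏ i, p i)) :
    gramMatrix (2 * ∏ i, p i) ⟨p i, hi⟩ ⟨p l, hl⟩ =
      (∑ j, addLegendreSym (-1) (p j) *
          (((legendreMatrix p)ᵀ + Matrix.diagonal fun i => addLegendreSym 2 (p i)) i j *
            ((legendreMatrix p)ᵀ + Matrix.diagonal fun i => addLegendreSym 2 (p i)) l j)) +
        (if i = l then addLegendreSym 2 (p i) else 0) +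
        (addLegendreSym 2 (p i) * addLegendreSym (-1) (p l) +
          addLegendreSym (-1) (p i) * addLegendreSym 2 (p l)) := by
  have hodd := odd_of_mod_eight_six p h8
  unfold gramMatrix
  rw [Matrix.of_apply]
  congr 1
  · congr 1
    · -- the sum over `S₂ = {p_j : p_j ≡ 3 (4)}`
      rw [Finset.sum_coe_sort (sTwoSet (2 * ∏ i, p i))
          (fun q => lam (2 * ∏ i, p i) q ((p i : ℕ) : ℤ) * lam (2 * ∏ i, p i) q ((p l : ℕ) : ℤ)),
        sTwoSet_two_mul_prod p hp hodd hinj h8, Finset.sum_image fun x _ y _ h => hinj h,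
        Finset.sum_filter]
      refine Finset.sum_congr rfl fun j _ => ?_
      rw [eps_eq_ite p hodd j]
      by_cases hj : p j % 4 = 1
      · rw [if_pos hj, if_neg (not_not.mpr hj), zero_mul]
      · rw [if_neg hj, if_pos hj, one_mul, lam_prime_prime_eq_shapeL p hp hodd hinj i j,
          lam_prime_prime_eq_shapeL p hp hodd hinj l j]
    · by_cases hil : i = l
      · subst hil
        rw [if_pos rfl, if_pos rfl, lam_two_prime p hp hodd]
      · have hne : (⟨p i, hi⟩ : ↥(sOneSet (2 * ∏ i, p i))) ≠ ⟨p l, hl⟩ := fun h =>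
          hil (hinj (Subtype.ext_iff.mp h))
        rw [if_neg hne, if_neg hil]
  · have hnu : nu (2 * ∏ i, p i) = 1 := by unfold nu; rw [if_pos (by omega)]
    rw [hnu, one_mul, lam_two_prime p hp hodd, lam_two_prime p hp hodd, epsTwo_eq p hodd,
      epsTwo_eq p hodd]

include hp hinj in
/-- **`v(Sel₀) ≅ W` and the Gram matrices correspond**: the rank of Aoki's `ᵗΦ G Φ` (typed basis-free as
`gramEssential`) is the rank of `(w ⬝ G w')_{w, w' ∈ W}`, `W = {u : (u ᵥ* L)_j = 0 ∀ j ∈ T₁}`.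
[cite: Aoki1999, Thm. 2.2 p. 81, §2 p. 80, Thm. 4.1 p. 87] -/
theorem rank_gramEssential_eq (h8 : (2 * ∏ i, p i) % 8 = 6) :
    (gramEssential (2 * ∏ i, p i)).rank =
      (Matrix.of fun w w' : ↥(Finset.univ.filter fun u : Fin k → ZMod 2 =>
          ∀ j, addLegendreSym (-1) (p j) = 0 →
            (u ᵥ* ((legendreMatrix p)ᵀ + Matrix.diagonal fun i => addLegendreSym 2 (p i))) j = 0) =>
        (w : Fin k → ZMod 2) ⬝ᵥ ((Matrix.of fun i l : Fin k =>
          (∑ j, addLegendreSym (-1) (p j) *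
              (((legendreMatrix p)ᵀ + Matrix.diagonal fun i => addLegendreSym 2 (p i)) i j *
                ((legendreMatrix p)ᵀ + Matrix.diagonal fun i => addLegendreSym 2 (p i)) l j)) +
            (if i = l then addLegendreSym 2 (p i) else 0) +
            (addLegendreSym 2 (p i) * addLegendreSym (-1) (p l) +
              addLegendreSym (-1) (p i) * addLegendreSym 2 (p l))) *ᵥ (w' : Fin k → ZMod 2))).rank := by
  have hodd := odd_of_mod_eight_six p h8
  have hn0 : (2 * ∏ i, p i) ≠ 0 :=
    mul_ne_zero two_ne_zero (Finset.prod_ne_zero_iff.mpr fun i _ => (hp i).ne_zero)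
  have hS1 := sOneSet_two_mul_prod p hp hodd hinj
  have hT := tSet_two_mul_prod p hp hinj h8
  have hmemS : ∀ i, p i ∈ sOneSet (2 * ∏ i, p i) := fun i => by
    rw [hS1]; exact Finset.mem_image_of_mem _ (Finset.mem_univ i)
  let eS : Fin k ≃ ↥(sOneSet (2 * ∏ i, p i)) := Equiv.ofBijective (fun i => ⟨p i, hmemS i⟩)
    ⟨fun i j h => hinj (Subtype.ext_iff.mp h), fun x => by
      obtain ⟨xv, hxv⟩ := x
      rw [hS1] at hxv
      obtain ⟨i, -, hi⟩ := Finset.mem_image.mp hxv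
      exact ⟨i, Subtype.ext hi⟩⟩
  have heS : ∀ i, (eS i : ℕ) = p i := fun i => rfl
  -- `rep` of any exponent vector is odd
  have hrep : ∀ w : ↥(sOneSet (2 * ∏ i, p i)) → ZMod 2, ¬ (2 : ℤ) ∣ rep (2 * ∏ i, p i) w := by
    intro w h
    unfold rep at h
    obtain ⟨⟨x, hx1⟩, -, hx⟩ := (Prime.dvd_finsetProd_iff Int.prime_two _).mp h
    have h2x : (2 : ℤ) ∣ (x : ℕ) := Int.prime_two.dvd_of_dvd_pow hx
    rw [hS1] at hx1
    obtain ⟨i, -, hi⟩ := Finset.mem_image.mp hx1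
    rw [← hi] at h2x
    have h2x' : 2 ∣ p i := by exact_mod_cast h2x
    exact (Nat.not_even_iff_odd.mpr (hodd i)) (even_iff_two_dvd.mpr h2x')
  -- membership in `v(Sel₀)` of the transported vector
  have hmemW : ∀ u : Fin k → ZMod 2,
      (fun x : ↥(sOneSet (2 * ∏ i, p i)) => u (eS.symm x)) ∈ essential (2 * ∏ i, p i) ↔
        ∀ j, addLegendreSym (-1) (p j) = 0 →
          (u ᵥ* ((legendreMatrix p)ᵀ + Matrix.diagonal fun i => addLegendreSym 2 (p i))) j = 0 := by
    intro u
    unfold essential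
    rw [Finset.mem_filter]
    simp only [Finset.mem_univ, true_and]
    have hcond : essentialCond (2 * ∏ i, p i)
        (rep (2 * ∏ i, p i) fun x : ↥(sOneSet (2 * ∏ i, p i)) => u (eS.symm x)) := by
      unfold essentialCond
      rw [if_neg (by omega), if_neg (by omega)]
      exact hrep _
    have hlam : ∀ q : ℕ, lam (2 * ∏ i, p i) q
        (rep (2 * ∏ i, p i) fun x : ↥(sOneSet (2 * ∏ i, p i)) => u (eS.symm x)) =
        ∑ i, u i * lam (2 * ∏ i, p i) q ((p i : ℕ) : ℤ) := by
      intro q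
      rw [lam_rep hn0]
      exact Fintype.sum_equiv eS.symm _ _ fun x => by
        rw [← heS (eS.symm x), Equiv.apply_symm_apply]
    constructor
    · rintro ⟨h, -⟩ j hj
      have hq : p j ∈ tSet (2 * ∏ i, p i) := by
        rw [hT]
        exact Finset.mem_image_of_mem _
          (Finset.mem_filter.mpr ⟨Finset.mem_univ _, (eps_eq_zero_iff p hodd j).mp hj⟩)
      have := h (p j) hq
      rw [hlam] at this
      rw [← this]
      simp only [Matrix.vecMul, dotProduct]
      exact Finset.sum_congr rfl fun i _ => by rw [lam_prime_prime_eq_shapeL p hp hodd hinj i j]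
    · intro h
      refine ⟨fun q hq => ?_, hcond⟩
      rw [hT] at hq
      obtain ⟨j, hj, rfl⟩ := Finset.mem_image.mp hq
      have hεj : addLegendreSym (-1) (p j) = 0 :=
        (eps_eq_zero_iff p hodd j).mpr (Finset.mem_filter.mp hj).2
      rw [hlam, ← h j hεj]
      simp only [Matrix.vecMul, dotProduct]
      exact Finset.sum_congr rfl fun i _ => by rw [lam_prime_prime_eq_shapeL p hp hodd hinj i j]
  -- the equivalence `W ≃ v(Sel₀)`
  have hWfin : ∀ u : Fin k → ZMod 2, u ∈ (Finset.univ.filter fun u : Fin k → ZMod 2 =>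
      ∀ j, addLegendreSym (-1) (p j) = 0 →
        (u ᵥ* ((legendreMatrix p)ᵀ + Matrix.diagonal fun i => addLegendreSym 2 (p i))) j = 0) ↔
      ∀ j, addLegendreSym (-1) (p j) = 0 →
        (u ᵥ* ((legendreMatrix p)ᵀ + Matrix.diagonal fun i => addLegendreSym 2 (p i))) j = 0 :=
    fun u => by rw [Finset.mem_filter]; simp only [Finset.mem_univ, true_and]
  have hback : ∀ w : ↥(sOneSet (2 * ∏ i, p i)) → ZMod 2,
      (fun x : ↥(sOneSet (2 * ∏ i, p i)) => (fun i => w (eS i)) (eS.symm x)) = w :=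
    fun w => funext fun x => by simp only [Equiv.apply_symm_apply]
  let eW : ↥(Finset.univ.filter fun u : Fin k → ZMod 2 =>
      ∀ j, addLegendreSym (-1) (p j) = 0 →
        (u ᵥ* ((legendreMatrix p)ᵀ + Matrix.diagonal fun i => addLegendreSym 2 (p i))) j = 0) ≃
      ↥(essential (2 * ∏ i, p i)) :=
    { toFun := fun u => ⟨fun x => (u : Fin k → ZMod 2) (eS.symm x), (hmemW _).mpr ((hWfin _).mp u.2)⟩
      invFun := fun w => ⟨fun i => (w : ↥(sOneSet (2 * ∏ i, p i)) → ZMod 2) (eS i),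
        (hWfin _).mpr ((hmemW _).mp (by rw [hback]; exact w.2))⟩
      left_inv := fun u => Subtype.ext (funext fun i => by
        simp only [Equiv.symm_apply_apply])
      right_inv := fun w => Subtype.ext (hback _) }
  -- the Gram matrices correspond
  rw [← Matrix.rank_submatrix (gramEssential (2 * ∏ i, p i)) eW eW]
  congr 1
  ext u u'
  rw [Matrix.submatrix_apply, Matrix.of_apply]
  unfold gramEssential
  rw [Matrix.of_apply]
  change (fun x => (u : Fin k → ZMod 2) (eS.symm x)) ⬝ᵥ (gramMatrix (2 * ∏ i, p i) *ᵥ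
      fun x => (u' : Fin k → ZMod 2) (eS.symm x)) = _
  simp only [dotProduct, Matrix.mulVec, Matrix.of_apply]
  refine (Fintype.sum_equiv eS _ _ fun i => ?_).symm
  rw [Equiv.symm_apply_apply]
  congr 1
  refine Fintype.sum_equiv eS _ _ fun l => ?_
  rw [Equiv.symm_apply_apply]
  congr 1
  exact (gramMatrix_prime_prime p hp hinj h8 i l (hmemS i) (hmemS l)).symm

include hp hinj in
/-- **AOKI = MONSKY FOR EVERY `k`.** For every injective family of primes `p₁, …, p_k` with
`n = 2p₁⋯p_k ≡ 6 (mod 8)`: Aoki's closed formula `selmerDimFormula n` for `dim_{𝔽₂} Sel^(2)(E_n/ℚ)`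
(Theorem 2.2: `1 + |S| + |T| − 2 rank Λ_{S,T} − rank ᵗΦ(ᵗΛΛ + Δ + Ω)Φ`) equals `2 + s(n)`, where
`s(n) = 2k − rank M` is Monsky's even matrix count (`M = ( Aᵀ + D₂  D₋₁ ; D₂  A + D₂ )`). Pure bookkeeping
between the two printed `2`-descents; no Selmer group enters.
[cite: Aoki1999, Thm. 2.2 p. 81 and its proof p. 98]
[cite: HeathBrown1994SelmerCongruentII, Appendix (Monsky), typescript p. 41 L20–L36] -/
theorem selmerDimFormula_two_mul_prod (h8 : (2 * ∏ i, p i) % 8 = 6) :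
    selmerDimFormula (2 * ∏ i, p i) = 2 + (monskySelmerRankEven p : ℤ) := by
  have hodd := odd_of_mod_eight_six p h8
  -- the kernel count for `L = Aᵀ + D_t`, `ε`, `t`
  have hK := finrank_ker_add_two_mul_rank_add_rank_gram
    ((legendreMatrix p)ᵀ + Matrix.diagonal fun i => addLegendreSym 2 (p i))
    (fun i => addLegendreSym (-1) (p i)) (fun i => addLegendreSym 2 (p i))
    (shapeL_transpose p hp hodd hinj) (shapeL_sum_col p) (sum_eps_eq_one p hodd h8)
    (Matrix.of fun i l : Fin k =>
      (∑ j, addLegendreSym (-1) (p j) *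
          (((legendreMatrix p)ᵀ + Matrix.diagonal fun i => addLegendreSym 2 (p i)) i j *
            ((legendreMatrix p)ᵀ + Matrix.diagonal fun i => addLegendreSym 2 (p i)) l j)) +
        (if i = l then addLegendreSym 2 (p i) else 0) +
        (addLegendreSym 2 (p i) * addLegendreSym (-1) (p l) +
          addLegendreSym (-1) (p i) * addLegendreSym 2 (p l)))
    (fun i l => rfl)
    (Finset.univ.filter fun u : Fin k → ZMod 2 =>
      ∀ j, addLegendreSym (-1) (p j) = 0 →
        (u ᵥ* ((legendreMatrix p)ᵀ + Matrix.diagonal fun i => addLegendreSym 2 (p i))) j = 0)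
    (fun u => by rw [Finset.mem_filter]; simp only [Finset.mem_univ, true_and])
  have hs : monskySelmerRankEven p = Module.finrank (ZMod 2) ↥(LinearMap.ker (Matrix.fromBlocks
      ((legendreMatrix p)ᵀ + Matrix.diagonal fun i => addLegendreSym 2 (p i))
      (Matrix.diagonal fun i => addLegendreSym (-1) (p i))
      (Matrix.diagonal fun i => addLegendreSym 2 (p i))
      ((legendreMatrix p)ᵀ + Matrix.diagonal fun i => addLegendreSym 2 (p i))ᵀ).mulVecLin) := by
    rw [monskySelmerRankEven_eq_finrank_ker, monskyMatrixEven_eq_fromBlocks]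
  rw [Fintype.card_fin] at hK
  unfold selmerDimFormula
  rw [card_sSet_two_mul_prod p hp hodd hinj, card_tSet_two_mul_prod p hp hodd hinj h8,
    rank_lamMatrix_eq p hp hinj h8, rank_gramEssential_eq p hp hinj h8, hs]
  push_cast
  omega

/-- **`#Sel₂(E_{2p₁⋯p_k}/ℚ) = 2^{2 + s(2p₁⋯p_k)}` for EVERY `k` from Aoki's Theorem 2.2 alone** (`hAo`,
refereed with complete proof): the `n ≡ 6 (mod 8)` case of Heath-Brown 1994's formula
`monsky_card_selmerGroup_two_even` (whose even case is printed as a sketch) follows from the named fact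
`thm22_card_selmerGroup_two`. Consumers: every uniform-in-`k` door of the typed even law C-P2-2 and the
`𝒮⁻`-towers (replace `hMe k p …` by this). [cite: Aoki1999, Thm. 2.2 p. 81]
[cite: HeathBrown1994SelmerCongruentII, Appendix (Monsky), typescript p. 41 L20–L36; §1 p. 1 L14–L20] -/
theorem card_selmerGroup_two_two_mul_prod_of_aoki (hAo : thm22_card_selmerGroup_two)
    {k : ℕ} (p : Fin k → ℕ) (hp : ∀ i, (p i).Prime) (hinj : Function.Injective p)
    (h8 : (2 * ∏ i, p i) % 8 = 6) :
    Nat.card ((congruentNumberCurve (2 * ∏ i, p i)).selmerGroup 2) =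
      2 ^ (2 + monskySelmerRankEven p) := by
  have hodd := odd_of_mod_eight_six p h8
  obtain ⟨d, hd, hd'⟩ := hAo (2 * ∏ i, p i)
    (Nat.pos_of_ne_zero (mul_ne_zero two_ne_zero
      (Finset.prod_ne_zero_iff.mpr fun i _ => (hp i).ne_zero)))
    (squarefree_two_mul_prod_of_injective p hp hodd hinj) (Or.inr (Or.inl h8))
  rw [selmerDimFormula_two_mul_prod p hp hinj h8] at hd'
  have hd2 : d = 2 + monskySelmerRankEven p := by omega
  rw [hd, hd2]

/-- **Monsky's even formula on the whole class `n ≡ 6 (mod 8)` from Aoki's Theorem 2.2** — the shape of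
`HeathBrown1994.monsky_card_selmerGroup_two_even` restricted to `2p₁⋯p_k ≡ 6 (mod 8)` (the hypothesis
«odd primes» is then automatic), for every `k`. [cite: Aoki1999, Thm. 2.2 p. 81]
[cite: HeathBrown1994SelmerCongruentII, Appendix (Monsky), typescript p. 41 L20–L36] -/
theorem monskyEven_six_of_aoki (hAo : thm22_card_selmerGroup_two) :
    ∀ (k : ℕ) (p : Fin k → ℕ), (∀ i, (p i).Prime) → Function.Injective p → (2 * ∏ i, p i) % 8 = 6 →
      Nat.card ((congruentNumberCurve (2 * ∏ i, p i)).selmerGroup 2) =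
        2 ^ (2 + monskySelmerRankEven p) :=
  fun _ p hp hinj h8 => card_selmerGroup_two_two_mul_prod_of_aoki hAo p hp hinj h8

end Summit.BirchSwinnertonDyer.Rank1Residual.P2.AokiMonsky

end
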